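import Summits.Ventures.PercRepro.Classify4
import Summits.Ventures.PercRepro.FaceGrouping
import Summits.Ventures.PercRepro.Induction

/-!
# PercRepro — C-011 = C-005⁺, the liability-strengthened crossing pair-sum (typer-2, gen 3)

`conjectures/C-011.md` (lead, 2026-08-22T03:44Z): for four marked vertices of a finite multigraph,
with `top = P(abcd)`, `bot = P(a|b|c|d)`, the crossing cells `x₁ = P(ab|cd)`, `x₂ = P(ac|bd)`,
`x₃ = P(ad|bc)` and the RANK-1 masses below them `r₁ = P(ab|c|d) + P(a|b|cd)`,
`r₂ = P(ac|b|d) + P(a|bd|c)`, `r₃ = P(ad|b|c) + P(a|bc|d)`,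

  **C-005⁺**: `top · bot ≥ x₁x₂ + x₁x₃ + x₂x₃ + Σ_{i ≠ j} x_i · r_j`.

Everything is stated on the 15 rows of the law `G.law4 p a b c d` (`SMC4.lean`, order `rgs4`:
`0 = abcd`, `3 = ab|cd`, `6 = ac|bd`, `8 = ad|bc`, `4 = ab|c|d`, `13 = a|b|cd`, `7 = ac|b|d`,
`12 = a|bd|c`, `11 = ad|b|c`, `10 = a|bc|d`, `14 = a|b|c|d`).

* **`C011`** (= `C005plus`), the product-level row; `C005_of_C011` (drop the liability terms);
* `PhiPlus` — the slack `Φ⁺ = top·bot − e₂(x) − Σ x_i r_j`; **`PhiPlus_edge_concave`** — the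
  single-edge CONCAVITY LEMMA of the dossier (`t ↦ Φ⁺(p[g := t])` concave on `[0, 1]`);
  **`C011_of_PhiPlus_edge_concave`** — the induction on free edges (typer-1 `induction_free`):
  base case = deterministic weights (`Φ⁺ = 0`), step = concavity;
* class level: `goodCount`, `badCount`, `liabilityCount` of a row map `f : Config S → Fin 15`
  (`g`, `b`, `n_xR` of the dossier), **`LemmaBPlus`** (`b + n_xR ≤ g` on every face of every
  marked multigraph — graph maps only: the abstract statement is false, dossier §(4)), and
  **`C011_of_LemmaBPlus`** through the two-copy face grouping (`twoCopy_eq_sum_faces`).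
-/

namespace PercRepro

open Finset

/-! ### The product-level row -/

namespace MultiGraph

variable {V E : Type*} (G : MultiGraph V E) [Fintype E] [DecidableEq E]

/-- The rank-1 masses below the crossing cells: `r₁ = P(ab|c|d) + P(a|b|cd)`,
`r₂ = P(ac|b|d) + P(a|bd|c)`, `r₃ = P(ad|b|c) + P(a|bc|d)`. -/
noncomputable def rank1Mass (p : E → ℝ) (a b c d : V) : Fin 3 → ℝ :=
  ![G.law4 p a b c d 4 + G.law4 p a b c d 13, G.law4 p a b c d 7 + G.law4 p a b c d 12,
    G.law4 p a b c d 11 + G.law4 p a b c d 10]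

/-- The crossing masses `x₁ = P(ab|cd)`, `x₂ = P(ac|bd)`, `x₃ = P(ad|bc)`. -/
noncomputable def crossMass (p : E → ℝ) (a b c d : V) : Fin 3 → ℝ :=
  ![G.law4 p a b c d 3, G.law4 p a b c d 6, G.law4 p a b c d 8]

/-- The liability sum `Σ_{i ≠ j} x_i · r_j`. -/
noncomputable def liabilitySum (p : E → ℝ) (a b c d : V) : ℝ :=
  ∑ i : Fin 3, ∑ j : Fin 3, if i ≠ j then G.crossMass p a b c d i * G.rank1Mass p a b c d j else 0

/-- The slack of C-005⁺: `Φ⁺ = top·bot − (x₁x₂ + x₁x₃ + x₂x₃) − Σ_{i ≠ j} x_i r_j`. -/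
noncomputable def PhiPlus (p : E → ℝ) (a b c d : V) : ℝ :=
  G.law4 p a b c d 0 * G.law4 p a b c d 14 -
    (G.law4 p a b c d 3 * G.law4 p a b c d 6 + G.law4 p a b c d 3 * G.law4 p a b c d 8 +
      G.law4 p a b c d 6 * G.law4 p a b c d 8) - G.liabilitySum p a b c d

/-- The liability sum, written out. -/
theorem liabilitySum_eq (p : E → ℝ) (a b c d : V) :
    G.liabilitySum p a b c d =
      G.law4 p a b c d 3 * (G.law4 p a b c d 7 + G.law4 p a b c d 12) +
      G.law4 p a b c d 3 * (G.law4 p a b c d 11 + G.law4 p a b c d 10) +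
      G.law4 p a b c d 6 * (G.law4 p a b c d 4 + G.law4 p a b c d 13) +
      G.law4 p a b c d 6 * (G.law4 p a b c d 11 + G.law4 p a b c d 10) +
      G.law4 p a b c d 8 * (G.law4 p a b c d 4 + G.law4 p a b c d 13) +
      G.law4 p a b c d 8 * (G.law4 p a b c d 7 + G.law4 p a b c d 12) := by
  simp only [liabilitySum, crossMass, rank1Mass, Fin.sum_univ_three]
  simp
  ring

end MultiGraph

/-- **C-011 = C-005⁺** (`conjectures/C-011.md`): for every finite multigraph, every
`p ∈ [0,1]^E` and every four marked vertices,
`x₁x₂ + x₁x₃ + x₂x₃ + Σ_{i ≠ j} x_i r_j ≤ top · bot` on the rows of `law4`. -/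
def C011 : Prop :=
  ∀ {V E : Type} [Fintype E] [DecidableEq E] (G : MultiGraph V E) (p : E → ℝ), IsProb p →
    ∀ a b c d : V,
      G.law4 p a b c d 3 * G.law4 p a b c d 6 + G.law4 p a b c d 3 * G.law4 p a b c d 8 +
          G.law4 p a b c d 6 * G.law4 p a b c d 8 + G.liabilitySum p a b c d ≤
        G.law4 p a b c d 0 * G.law4 p a b c d 14

/-- C-005⁺ is the row C-011 (the lead's name for it). -/
abbrev C005plus : Prop := C011

/-- C-011 says exactly that the slack `Φ⁺` is nonnegative. -/
theorem C011_iff_phiPlus_nonneg : C011 ↔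
    ∀ {V E : Type} [Fintype E] [DecidableEq E] (G : MultiGraph V E) (p : E → ℝ), IsProb p →
      ∀ a b c d : V, 0 ≤ G.PhiPlus p a b c d := by
  constructor
  · intro h V E _ _ G p hp a b c d
    have := h G p hp a b c d
    unfold MultiGraph.PhiPlus
    linarith
  · intro h V E _ _ G p hp a b c d
    have := h G p hp a b c d
    unfold MultiGraph.PhiPlus at this
    linarith

/-- The liability sum is nonnegative. -/
theorem MultiGraph.liabilitySum_nonneg {V E : Type*} (G : MultiGraph V E) [Fintype E]
    [DecidableEq E] {p : E → ℝ} (hp : IsProb p) (a b c d : V) :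
    0 ≤ G.liabilitySum p a b c d := by
  unfold MultiGraph.liabilitySum
  refine Finset.sum_nonneg fun i _ => Finset.sum_nonneg fun j _ => ?_
  split_ifs
  · refine mul_nonneg ?_ ?_
    · fin_cases i <;> simp [MultiGraph.crossMass, MultiGraph.law4, prob_nonneg hp]
    · fin_cases j <;> simp [MultiGraph.rank1Mass, MultiGraph.law4] <;>
        exact add_nonneg (prob_nonneg hp _) (prob_nonneg hp _)
  · exact le_rfl

/-- **C-005⁺ implies C-005** (drop the nonnegative liability sum). -/
theorem C005_of_C011 (h : C011) : C005 := by
  intro V E _ _ G p hp a b c d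
  have key := h G p hp a b c d
  have hl := G.liabilitySum_nonneg hp a b c d
  obtain ⟨h0, h14, h3, h6, h8⟩ := G.law4_C005_rows p a b c d
  rw [h0, h14, h3, h6, h8] at key
  linarith

/-! ### The single-edge concavity lemma and the induction on free edges -/

/-- **The concavity lemma** (`conjectures/C-011.md` §EDGE-CONCAVITY): for every edge `g`, the
slack `Φ⁺` is a concave function of the weight `p_g ∈ [0, 1]` (all other weights fixed). -/
def PhiPlus_edge_concave : Prop :=
  ∀ {V E : Type} [Fintype E] [DecidableEq E] (G : MultiGraph V E) (p : E → ℝ), IsProb p →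
    ∀ (a b c d : V) (g : E),
      ConcaveOn ℝ (Set.Icc (0 : ℝ) 1) fun t => G.PhiPlus (Function.update p g t) a b c d

namespace MultiGraph

variable {V E : Type*} (G : MultiGraph V E) [Fintype E] [DecidableEq E]

/-- Under deterministic weights the law of the marked partition is a point mass on the row of the
configuration. -/
theorem law4_detWeights (σ : Config E) (a b c d : V) (s : Fin 15) :
    G.law4 (detWeights σ) a b c d s =
      if row4 (G.markedPartition σ ![a, b, c, d]) = s then 1 else 0 := by
  classical
  rw [law4, prob_detWeights_eq_ite]
  simp only [← G.row4_markedPartition_eq_iff]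

/-- Under deterministic weights the slack `Φ⁺` vanishes (one row carries all the mass, and every
product in `Φ⁺` pairs two distinct rows). -/
theorem phiPlus_detWeights (σ : Config E) (a b c d : V) :
    G.PhiPlus (detWeights σ) a b c d = 0 := by
  simp only [PhiPlus, liabilitySum_eq, law4_detWeights]
  generalize row4 (G.markedPartition σ ![a, b, c, d]) = t
  fin_cases t <;> simp [Fin.ext_iff]

end MultiGraph

/-- **C-005⁺ from the concavity lemma** by induction on the free edges (typer-1's
`induction_free`): with all weights deterministic `Φ⁺ = 0`; freeing one edge `g`, concavity of
`t ↦ Φ⁺(p[g := t])` on `[0, 1]` gives `Φ⁺(p) ≥ min(Φ⁺(p[g := 0]), Φ⁺(p[g := 1])) ≥ 0`. -/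
theorem C011_of_PhiPlus_edge_concave (hconc : PhiPlus_edge_concave) : C011 := by
  rw [C011_iff_phiPlus_nonneg]
  intro V E _ _ G p hp a b c d
  refine induction_free (P := fun q => 0 ≤ G.PhiPlus q a b c d) ?_ ?_ hp
  · intro σ
    rw [G.phiPlus_detWeights]
  · intro q g hq h1 h0
    have hc := hconc G q hq a b c d g
    have hg0 : (0 : ℝ) ≤ q g := hq.nonneg g
    have hg1 : q g ≤ 1 := hq.le_one g
    have key := hc.2 (Set.left_mem_Icc.mpr zero_le_one) (Set.right_mem_Icc.mpr zero_le_one)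
      (sub_nonneg.mpr hg1) hg0 (by ring)
    simp only [smul_eq_mul, mul_zero, zero_add, mul_one] at key
    have hself : Function.update q g (q g) = q := Function.update_eq_self g q
    rw [hself] at key
    nlinarith [mul_nonneg (sub_nonneg.mpr hg1) h0, mul_nonneg hg0 h1]

/-! ### The class level: Lemma B⁺ -/

/-- The three crossing row pairs `(x_i, x_j)`, `i < j`: `(ab|cd, ac|bd)`, `(ab|cd, ad|bc)`,
`(ac|bd, ad|bc)`. -/
def crossPairs4 : Finset (Fin 15 × Fin 15) := {(3, 6), (3, 8), (6, 8)}

/-- The twelve LIABILITY row pairs `(x_i, R)` with `R ⋖ x_j` a rank-1 cell below a DIFFERENT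
crossing cell (`R ∈ {ab|c|d, a|b|cd}` below `ab|cd`, `{ac|b|d, a|bd|c}` below `ac|bd`,
`{ad|b|c, a|bc|d}` below `ad|bc`). -/
def liabPairs4 : Finset (Fin 15 × Fin 15) :=
  {(3, 7), (3, 12), (3, 11), (3, 10), (6, 4), (6, 13), (6, 11), (6, 10),
   (8, 4), (8, 13), (8, 7), (8, 12)}

section Counts

variable {S : Type*} [Fintype S] [DecidableEq S]

/-- The number of `ρ` with `(f ρ, f ρᶜ) = q` (antipodal pairs of a given ordered row type). -/
def pairCount (f : Config S → Fin 15) (q : Fin 15 × Fin 15) : ℕ :=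
  (Finset.univ.filter fun ρ : Config S => f ρ = q.1 ∧ f ρᶜ = q.2).card

/-- `g`: the antipodal pairs `(⊤, ⊥)`. -/
def goodCount (f : Config S → Fin 15) : ℕ := pairCount f (0, 14)

/-- `b`: the unordered antipodal pairs in two distinct crossing cells (counted by the member in
the lower-indexed cell). -/
def badCount (f : Config S → Fin 15) : ℕ := ∑ q ∈ crossPairs4, pairCount f q

/-- `n_xR`: the LIABILITY pairs — unordered antipodal pairs `{σ, σ̄}` with `f σ = x_i` and `f σ̄ = R`,
`R ⋖ x_j`, `j ≠ i` (counted by the member in the crossing cell). -/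
def liabilityCount (f : Config S → Fin 15) : ℕ := ∑ q ∈ liabPairs4, pairCount f q

/-- `pairCount` as a real sum. -/
theorem pairCount_eq_sum (f : Config S → Fin 15) (q : Fin 15 × Fin 15) :
    (pairCount f q : ℝ) = ∑ ρ : Config S, if f ρ = q.1 ∧ f ρᶜ = q.2 then 1 else 0 := by
  rw [pairCount, Finset.card_filter]
  push_cast
  rfl

end Counts

/-- The row kernel of `Φ⁺`: `K⁺(s, t) = [s = ⊤ ∧ t = ⊥] − [(s, t) crossing] − [(s, t) liability]`. -/
def phiPlusKernel (s t : Fin 15) : ℝ :=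
  (if s = 0 ∧ t = 14 then 1 else 0) - (∑ q ∈ crossPairs4, if s = q.1 ∧ t = q.2 then 1 else 0) -
    ∑ q ∈ liabPairs4, if s = q.1 ∧ t = q.2 then 1 else 0

/-- The antipodal sum of `K⁺` on a cube is `g − b − n_xR`. -/
theorem sum_phiPlusKernel_compl {S : Type*} [Fintype S] [DecidableEq S] (f : Config S → Fin 15) :
    ∑ ρ : Config S, phiPlusKernel (f ρ) (f ρᶜ) =
      (goodCount f : ℝ) - badCount f - liabilityCount f := by
  simp only [phiPlusKernel, Finset.sum_sub_distrib, goodCount, badCount, liabilityCount]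
  push_cast
  simp only [pairCount_eq_sum]
  rw [Finset.sum_comm (s := Finset.univ) (t := crossPairs4),
    Finset.sum_comm (s := Finset.univ) (t := liabPairs4)]

/-- **Lemma B⁺** (`conjectures/C-011.md`, class level; GRAPH MAPS ONLY — for abstract monotone
maps it is false): on every face `[v, u]` of the cube of every marked multigraph, the row map
`ρ ↦ row4 Π(embed ρ)` of the percolation partition satisfies `b + n_xR ≤ g`. -/
def LemmaBPlus : Prop :=
  ∀ {V E : Type} [Fintype E] [DecidableEq E] (G : MultiGraph V E) (a b c d : V)
    (u v : Config E), v ≤ u →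
      badCount (fun ρ : Config (Face u v) => row4 (G.markedPartition (embed u v ρ) ![a, b, c, d])) +
        liabilityCount
          (fun ρ : Config (Face u v) => row4 (G.markedPartition (embed u v ρ) ![a, b, c, d])) ≤
      goodCount (fun ρ : Config (Face u v) => row4 (G.markedPartition (embed u v ρ) ![a, b, c, d]))

namespace MultiGraph

variable {V E : Type*} (G : MultiGraph V E) [Fintype E] [DecidableEq E]

/-- A row of the law as a weighted count of configurations. -/
theorem law4_eq_sum_row (p : E → ℝ) (a b c d : V) (s : Fin 15) :
    G.law4 p a b c d s =
      ∑ ω : Config E, weight p ω * if row4 (G.markedPartition ω ![a, b, c, d]) = s then 1 else 0 := by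
  classical
  rw [law4, prob]
  refine Finset.sum_congr rfl fun ω _ => ?_
  rw [Set.indicator_apply]
  by_cases h : ω ∈ G.partitionEvent ![a, b, c, d] (rgs4 s)
  · rw [if_pos h, if_pos ((G.row4_markedPartition_eq_iff _ _).mpr h), mul_one]
  · rw [if_neg h, if_neg (fun h' => h ((G.row4_markedPartition_eq_iff _ _).mp h')), mul_zero]

/-- A product of two rows of the law as a two-copy sum. -/
theorem law4_mul_law4 (p : E → ℝ) (a b c d : V) (s t : Fin 15) :
    G.law4 p a b c d s * G.law4 p a b c d t =
      ∑ ω : Config E, ∑ ω' : Config E, weight p ω * weight p ω' *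
        if row4 (G.markedPartition ω ![a, b, c, d]) = s ∧
            row4 (G.markedPartition ω' ![a, b, c, d]) = t then 1 else 0 := by
  rw [law4_eq_sum_row, law4_eq_sum_row, Finset.sum_mul_sum]
  refine Finset.sum_congr rfl fun ω _ => Finset.sum_congr rfl fun ω' _ => ?_
  split_ifs <;> simp_all

/-- The crossing pair-sum `x₁x₂ + x₁x₃ + x₂x₃` as a sum over `crossPairs4`. -/
theorem e2_eq_sum_crossPairs4 (p : E → ℝ) (a b c d : V) :
    G.law4 p a b c d 3 * G.law4 p a b c d 6 + G.law4 p a b c d 3 * G.law4 p a b c d 8 +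
        G.law4 p a b c d 6 * G.law4 p a b c d 8 =
      ∑ q ∈ crossPairs4, G.law4 p a b c d q.1 * G.law4 p a b c d q.2 := by
  simp [crossPairs4, Finset.sum_insert]
  ring

/-- The liability sum as a sum over `liabPairs4`. -/
theorem liabilitySum_eq_sum_liabPairs4 (p : E → ℝ) (a b c d : V) :
    G.liabilitySum p a b c d = ∑ q ∈ liabPairs4, G.law4 p a b c d q.1 * G.law4 p a b c d q.2 := by
  rw [liabilitySum_eq]
  simp [liabPairs4, Finset.sum_insert]
  ring

/-- **`Φ⁺` as a two-copy sum** with the row kernel `K⁺`. -/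
theorem phiPlus_eq_twoCopy (p : E → ℝ) (a b c d : V) :
    G.PhiPlus p a b c d = ∑ ω : Config E, ∑ ω' : Config E, weight p ω * weight p ω' *
      phiPlusKernel (row4 (G.markedPartition ω ![a, b, c, d]))
        (row4 (G.markedPartition ω' ![a, b, c, d])) := by
  rw [PhiPlus, e2_eq_sum_crossPairs4, liabilitySum_eq_sum_liabPairs4]
  simp only [law4_mul_law4, phiPlusKernel, mul_sub, Finset.mul_sum, Finset.sum_sub_distrib]
  congr 1
  congr 1
  · exact Finset.sum_comm.trans (Finset.sum_congr rfl fun ω _ => Finset.sum_comm)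
  · exact Finset.sum_comm.trans (Finset.sum_congr rfl fun ω _ => Finset.sum_comm)

end MultiGraph

/-- **Lemma B⁺ implies C-005⁺**: group the two-copy sum by join and meet
(`twoCopy_eq_sum_faces`); every face term is `w(u) w(v) · (g − b − n_xR) ≥ 0`. -/
theorem C011_of_LemmaBPlus (hB : LemmaBPlus) : C011 := by
  rw [C011_iff_phiPlus_nonneg]
  intro V E _ _ G p hp a b c d
  rw [G.phiPlus_eq_twoCopy, twoCopy_eq_sum_faces p
    (fun ω => row4 (G.markedPartition ω ![a, b, c, d])) phiPlusKernel]
  refine Finset.sum_nonneg fun uv _ => ?_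
  refine mul_nonneg (mul_nonneg (weight_nonneg hp _) (weight_nonneg hp _)) ?_
  split_ifs with hle
  · have key := hB G a b c d uv.1 uv.2 hle
    have h := sum_phiPlusKernel_compl
      (fun ρ : Config (Face uv.1 uv.2) => row4 (G.markedPartition (embed uv.1 uv.2 ρ) ![a, b, c, d]))
    rw [h]
    have : ((badCount (fun ρ : Config (Face uv.1 uv.2) =>
        row4 (G.markedPartition (embed uv.1 uv.2 ρ) ![a, b, c, d])) +
        liabilityCount (fun ρ : Config (Face uv.1 uv.2) =>
          row4 (G.markedPartition (embed uv.1 uv.2 ρ) ![a, b, c, d])) : ℕ) : ℝ) ≤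
        (goodCount (fun ρ : Config (Face uv.1 uv.2) =>
          row4 (G.markedPartition (embed uv.1 uv.2 ρ) ![a, b, c, d])) : ℝ) := by
      exact_mod_cast key
    push_cast at this
    linarith
  · exact le_rfl

/-- **Lemma B⁺ implies C-005** (through C-005⁺). -/
theorem C005_of_LemmaBPlus (hB : LemmaBPlus) : C005 := C005_of_C011 (C011_of_LemmaBPlus hB)

end PercRepro
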